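import Summits.SmoothPoincare4.SmoothPoincare4.Theses.EntropyRung
import Literature.Geometry.Riemannian.BakryEmeryHeatFlow
import Literature.Geometry.Lorentzian.GreenIdentity
import Literature.Geometry.Lorentzian.VolumePositivity
import Literature.Geometry.Lorentzian.CurvatureRegularity
import Mathlib.Analysis.Convex.Integral
import Mathlib.Analysis.SpecialFunctions.Log.NegMulLog
import HarnessLib

/-!
# Localisation of Perelman's `𝒲`-functional under a two-piece partition `χ₁² + χ₂² = 1`
(helper for stub `stub_conformalGluing` of line `green-blowup-conformal-entropy`, crux
`EntropyRung.SubcylindricalExistence`, item stmt-SmoothPoincare4-10871)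

For a smooth Riemannian metric `g` (Levi-Civita connection) on a closed 4-manifold of the summit
binder, `τ > 0`, `c = (4πτ)⁻²`, and a smooth `v`, write (Perelman's `𝒲(g, f, τ)` with `e^{-f} = v²`)
`𝒲(v) = ∫ [τ (R v² + 4|∇v|²) − v² log v² − 4 v²] c dV`. For smooth `χ₁, χ₂` with `χ₁² + χ₂² = 1`
and a smooth `w` with `∫ c w² dV = 1` we prove the **localisation inequality**
`𝒲(w) ≥ 𝒲(χ₁ w) + 𝒲(χ₂ w) + m₁ log m₁ + m₂ log m₂ − 4τ ∫ c w² (|∇χ₁|² + |∇χ₂|²) dV`,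
`mᵢ = ∫ c (χᵢ w)² dV` (`wEntropy_localisation_two`). Ingredients: the IMS formula
`|∇(χ₁w)|² + |∇(χ₂w)|² = |∇w|² + w²(|∇χ₁|² + |∇χ₂|²)` (`gradSq_localisation_two`, from
`χ₁ dχ₁ + χ₂ dχ₂ = 0`), the pointwise splitting of `v² log v²`, and Jensen's inequality for
`s ↦ s log s` and the probability measure `c w² dV` (`∫ c w² χᵢ² log χᵢ² ≥ mᵢ log mᵢ`). This is
the "IMS localisation with mixing entropy paid by concavity" step of the gluing stub D (and of
`stub_coneCapping` of line `fat-conical-core-avr-logsobolev`). References: Cycon–Froese–Kirsch–Simon,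
*Schrödinger Operators* (1987), Thm. 3.2 (IMS localisation formula); Perelman 2002, §3.
-/

noncomputable section

-- the registered namespace `Summit.SmoothPoincare4.SmoothPoincare4.Theorems` repeats a component
set_option linter.dupNamespace false

open scoped Manifold ContDiff Topology ENNReal NNReal
open Set Filter MeasureTheory
open Literature.Geometry.Lorentzian Literature.Geometry.Riemannian

namespace Summit.SmoothPoincare4.SmoothPoincare4.Theorems

namespace EntropyLocalisation

variable {M : Type} [TopologicalSpace M]
  [ChartedSpace (EuclideanSpace ℝ (Fin 4)) M] [IsManifold (𝓡 4) ∞ M]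
  (g : PseudoRiemannianMetric (𝓡 4) ∞ (EuclideanSpace ℝ (Fin 4)) (TangentSpace (𝓡 4) : M → Type _))

/-! ### Pointwise identities -/

omit [IsManifold (𝓡 4) ∞ M] in
/-- Product rule for the covector: `d(χ w) = χ dw + w dχ`. -/
theorem dcov_mul {χ w : M → ℝ} {x : M} (hχ : MDifferentiableAt (𝓡 4) 𝓘(ℝ, ℝ) χ x)
    (hw : MDifferentiableAt (𝓡 4) 𝓘(ℝ, ℝ) w x) :
    (mvfderiv (𝓡 4) (fun y ↦ χ y * w y) x : TangentSpace (𝓡 4) x →ₗ[ℝ] ℝ) = χ x • (mvfderiv (𝓡 4) w x : TangentSpace (𝓡 4) x →ₗ[ℝ] ℝ) + w x • (mvfderiv (𝓡 4) χ x : TangentSpace (𝓡 4) x →ₗ[ℝ] ℝ) := by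
  rw [mvfderiv_fun_mul hχ hw, ContinuousLinearMap.toLinearMap_add,
    ContinuousLinearMap.toLinearMap_smul, ContinuousLinearMap.toLinearMap_smul]

/-- `|∇(χ w)|² = χ² |∇w|² + 2 χ w g⁻¹(dχ, dw) + w² |∇χ|²`. -/
theorem gradSq_mul {χ w : M → ℝ} {x : M} (hχ : MDifferentiableAt (𝓡 4) 𝓘(ℝ, ℝ) χ x)
    (hw : MDifferentiableAt (𝓡 4) 𝓘(ℝ, ℝ) w x) :
    g.gradSq (fun y ↦ χ y * w y) x =
      χ x ^ 2 * g.gradSq w x + 2 * (χ x * w x) * g.innerDual x ((mvfderiv (𝓡 4) χ x : TangentSpace (𝓡 4) x →ₗ[ℝ] ℝ)) ((mvfderiv (𝓡 4) w x : TangentSpace (𝓡 4) x →ₗ[ℝ] ℝ))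
        + w x ^ 2 * g.gradSq χ x := by
  simp only [PseudoRiemannianMetric.gradSq]
  rw [dcov_mul hχ hw]
  simp only [g.innerDual_add_left, g.innerDual_smul_left,
    g.innerDual_comm x ((mvfderiv (𝓡 4) w x : TangentSpace (𝓡 4) x →ₗ[ℝ] ℝ)) (χ x • (mvfderiv (𝓡 4) w x : TangentSpace (𝓡 4) x →ₗ[ℝ] ℝ) + w x • (mvfderiv (𝓡 4) χ x : TangentSpace (𝓡 4) x →ₗ[ℝ] ℝ)),
    g.innerDual_comm x ((mvfderiv (𝓡 4) χ x : TangentSpace (𝓡 4) x →ₗ[ℝ] ℝ)) (χ x • (mvfderiv (𝓡 4) w x : TangentSpace (𝓡 4) x →ₗ[ℝ] ℝ) + w x • (mvfderiv (𝓡 4) χ x : TangentSpace (𝓡 4) x →ₗ[ℝ] ℝ)),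
    g.innerDual_comm x ((mvfderiv (𝓡 4) w x : TangentSpace (𝓡 4) x →ₗ[ℝ] ℝ)) ((mvfderiv (𝓡 4) χ x : TangentSpace (𝓡 4) x →ₗ[ℝ] ℝ))]
  change _ = χ x ^ 2 * g.innerDual x ((mvfderiv (𝓡 4) w x : TangentSpace (𝓡 4) x →ₗ[ℝ] ℝ)) ((mvfderiv (𝓡 4) w x : TangentSpace (𝓡 4) x →ₗ[ℝ] ℝ)) + _ +
    w x ^ 2 * g.innerDual x ((mvfderiv (𝓡 4) χ x : TangentSpace (𝓡 4) x →ₗ[ℝ] ℝ)) ((mvfderiv (𝓡 4) χ x : TangentSpace (𝓡 4) x →ₗ[ℝ] ℝ))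
  ring

omit [IsManifold (𝓡 4) ∞ M] in
/-- If `χ₁² + χ₂² = 1` then `χ₁ dχ₁ + χ₂ dχ₂ = 0`. -/
theorem dcov_partition {χ₁ χ₂ : M → ℝ} (h1 : ∀ y, χ₁ y ^ 2 + χ₂ y ^ 2 = 1) {x : M}
    (hχ₁ : MDifferentiableAt (𝓡 4) 𝓘(ℝ, ℝ) χ₁ x) (hχ₂ : MDifferentiableAt (𝓡 4) 𝓘(ℝ, ℝ) χ₂ x) :
    χ₁ x • (mvfderiv (𝓡 4) χ₁ x : TangentSpace (𝓡 4) x →ₗ[ℝ] ℝ) + χ₂ x • (mvfderiv (𝓡 4) χ₂ x : TangentSpace (𝓡 4) x →ₗ[ℝ] ℝ) = 0 := by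
  have hsq1 : MDifferentiableAt (𝓡 4) 𝓘(ℝ, ℝ) (fun y ↦ χ₁ y * χ₁ y) x := hχ₁.mul hχ₁
  have hsq2 : MDifferentiableAt (𝓡 4) 𝓘(ℝ, ℝ) (fun y ↦ χ₂ y * χ₂ y) x := hχ₂.mul hχ₂
  have hfun : (fun y ↦ χ₁ y * χ₁ y) + (fun y ↦ χ₂ y * χ₂ y) = fun _ ↦ (1 : ℝ) := by
    funext y
    simp only [Pi.add_apply]
    have := h1 y
    nlinarith [this]
  have hd : mvfderiv (𝓡 4) ((fun y ↦ χ₁ y * χ₁ y) + (fun y ↦ χ₂ y * χ₂ y)) x = 0 := by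
    rw [hfun, mvfderiv_const]
  rw [mvfderiv_add hsq1 hsq2, mvfderiv_fun_mul hχ₁ hχ₁, mvfderiv_fun_mul hχ₂ hχ₂] at hd
  have hd' := congrArg (fun L : TangentSpace (𝓡 4) x →L[ℝ] ℝ ↦ (L : TangentSpace (𝓡 4) x →ₗ[ℝ] ℝ)) hd
  simp only [ContinuousLinearMap.toLinearMap_add, ContinuousLinearMap.toLinearMap_smul,
    ContinuousLinearMap.toLinearMap_zero] at hd'
  -- `hd' : χ₁•dχ₁ + χ₁•dχ₁ + (χ₂•dχ₂ + χ₂•dχ₂) = 0`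
  have h2 : (2 : ℝ) • (χ₁ x • (mvfderiv (𝓡 4) χ₁ x : TangentSpace (𝓡 4) x →ₗ[ℝ] ℝ) +
      χ₂ x • (mvfderiv (𝓡 4) χ₂ x : TangentSpace (𝓡 4) x →ₗ[ℝ] ℝ)) = 0 := by
    rw [two_smul]
    calc _ = χ₁ x • (mvfderiv (𝓡 4) χ₁ x : TangentSpace (𝓡 4) x →ₗ[ℝ] ℝ) +
          χ₁ x • (mvfderiv (𝓡 4) χ₁ x : TangentSpace (𝓡 4) x →ₗ[ℝ] ℝ) +
          (χ₂ x • (mvfderiv (𝓡 4) χ₂ x : TangentSpace (𝓡 4) x →ₗ[ℝ] ℝ) +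
            χ₂ x • (mvfderiv (𝓡 4) χ₂ x : TangentSpace (𝓡 4) x →ₗ[ℝ] ℝ)) := by abel
      _ = 0 := hd'
  exact (smul_eq_zero.mp h2).resolve_left two_ne_zero

/-- **IMS localisation formula** (two pieces): if `χ₁² + χ₂² = 1` then
`|∇(χ₁ w)|² + |∇(χ₂ w)|² = |∇w|² + w² (|∇χ₁|² + |∇χ₂|²)`. Cycon–Froese–Kirsch–Simon, Thm. 3.2. -/
theorem gradSq_localisation_two {χ₁ χ₂ w : M → ℝ} (h1 : ∀ y, χ₁ y ^ 2 + χ₂ y ^ 2 = 1) {x : M}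
    (hχ₁ : MDifferentiableAt (𝓡 4) 𝓘(ℝ, ℝ) χ₁ x) (hχ₂ : MDifferentiableAt (𝓡 4) 𝓘(ℝ, ℝ) χ₂ x)
    (hw : MDifferentiableAt (𝓡 4) 𝓘(ℝ, ℝ) w x) :
    g.gradSq (fun y ↦ χ₁ y * w y) x + g.gradSq (fun y ↦ χ₂ y * w y) x =
      g.gradSq w x + w x ^ 2 * (g.gradSq χ₁ x + g.gradSq χ₂ x) := by
  rw [gradSq_mul g hχ₁ hw, gradSq_mul g hχ₂ hw]
  have hcross : χ₁ x * g.innerDual x ((mvfderiv (𝓡 4) χ₁ x : TangentSpace (𝓡 4) x →ₗ[ℝ] ℝ)) ((mvfderiv (𝓡 4) w x : TangentSpace (𝓡 4) x →ₗ[ℝ] ℝ)) +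
      χ₂ x * g.innerDual x ((mvfderiv (𝓡 4) χ₂ x : TangentSpace (𝓡 4) x →ₗ[ℝ] ℝ)) ((mvfderiv (𝓡 4) w x : TangentSpace (𝓡 4) x →ₗ[ℝ] ℝ)) = 0 := by
    rw [← g.innerDual_smul_left, ← g.innerDual_smul_left, ← g.innerDual_add_left,
      dcov_partition h1 hχ₁ hχ₂]
    simp [PseudoRiemannianMetric.innerDual]
  have hsq := h1 x
  have : χ₁ x ^ 2 * g.gradSq w x + χ₂ x ^ 2 * g.gradSq w x = g.gradSq w x := by
    rw [← add_mul, hsq, one_mul]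
  linear_combination this + 2 * w x * hcross

/-- Pointwise splitting of the entropy density: `(χ w)² log (χ w)² = χ² (w² log w²) + w² (χ² log χ²)`
(both sides vanish where `χ w = 0`; elsewhere `log` of a product). -/
theorem sq_mul_log_sq_mul (a b : ℝ) :
    (a * b) ^ 2 * Real.log ((a * b) ^ 2) =
      a ^ 2 * (b ^ 2 * Real.log (b ^ 2)) + b ^ 2 * (a ^ 2 * Real.log (a ^ 2)) := by
  by_cases ha : a = 0
  · simp [ha]
  by_cases hb : b = 0
  · simp [hb]
  rw [mul_pow, Real.log_mul (pow_ne_zero 2 ha) (pow_ne_zero 2 hb)]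
  ring

/-! ### Integrability of the densities on a closed manifold -/

/-- The `𝒲`-density `(τ (R v² + 4|∇v|²) − v² log v² − 4 v²) c` of a smooth `v` is continuous. -/
theorem continuous_wDensity [g.HasLeviCivita] {v : M → ℝ} (hv : ContMDiff (𝓡 4) 𝓘(ℝ, ℝ) ∞ v)
    (τ c : ℝ) :
    Continuous fun x ↦ (τ * (g.scalarCurvature x * v x ^ 2 + 4 * g.gradSq v x)
      - v x ^ 2 * Real.log (v x ^ 2) - 4 * v x ^ 2) * c := by
  have hR : Continuous g.scalarCurvature := g.contMDiff_scalarCurvature.continuous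
  have hG : Continuous (g.gradSq v) := (contMDiff_gradSq g hv).continuous
  have hvc : Continuous v := hv.continuous
  have hv2 : Continuous fun x ↦ v x ^ 2 := hvc.pow 2
  have hlog : Continuous fun x ↦ v x ^ 2 * Real.log (v x ^ 2) :=
    Real.continuous_mul_log.comp hv2
  have h1 : Continuous fun x ↦ τ * (g.scalarCurvature x * v x ^ 2 + 4 * g.gradSq v x) :=
    continuous_const.mul ((hR.mul hv2).add (continuous_const.mul hG))
  have h2 : Continuous fun x ↦ 4 * v x ^ 2 := continuous_const.mul hv2
  exact ((h1.sub hlog).sub h2).mul continuous_const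

section Integral

variable [CompactSpace M] [T3Space M] [MeasurableSpace M] [BorelSpace M]

omit [ChartedSpace (EuclideanSpace ℝ (Fin 4)) M] [IsManifold (𝓡 4) ∞ M] [T3Space M] in
/-- A continuous function on the closed manifold is integrable for every FINITE measure on it
(bounded by compactness). -/
theorem integrable_of_continuous_finite {F : M → ℝ} (hF : Continuous F) (ν : Measure M)
    [IsFiniteMeasure ν] : Integrable F ν := by
  obtain ⟨C, hC⟩ := (isCompact_range hF).isBounded.exists_norm_le
  exact Integrable.of_bound hF.aestronglyMeasurable C (ae_of_all _ fun x ↦ hC _ ⟨x, rfl⟩)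

/-- A continuous real function on the closed manifold is integrable for the Riemannian measure. -/
theorem integrable_of_continuous (hg : g.IsRiemannian) {F : M → ℝ} (hF : Continuous F) :
    Integrable F (riemannianMeasure (g.toContMDiffRiemannianMetric hg)) := by
  haveI := isFiniteMeasure_riemannianMeasure (g.toContMDiffRiemannianMetric hg)
  exact integrable_of_continuous_finite hF _

/-- **Mixing entropy is paid by convexity (Jensen).** For continuous `w, χ` and `c ≥ 0` with
`∫ c w² dV = 1`, the probability measure `c w² dV` and the convex function `s ↦ s log s` give
`m log m ≤ ∫ c w² (χ² log χ²) dV`, `m = ∫ c w² χ² dV`. -/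
theorem mul_log_le_integral_of_sq_density (hg : g.IsRiemannian) {w χ : M → ℝ} (hw : Continuous w)
    (hχ : Continuous χ)
    {c : ℝ} (hc : 0 ≤ c)
    (hnorm : ∫ x, c * w x ^ 2 ∂(riemannianMeasure (g.toContMDiffRiemannianMetric hg)) = 1) :
    (∫ x, c * w x ^ 2 * χ x ^ 2 ∂(riemannianMeasure (g.toContMDiffRiemannianMetric hg))) *
        Real.log (∫ x, c * w x ^ 2 * χ x ^ 2 ∂(riemannianMeasure (g.toContMDiffRiemannianMetric hg)))
      ≤ ∫ x, c * w x ^ 2 * (χ x ^ 2 * Real.log (χ x ^ 2))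
          ∂(riemannianMeasure (g.toContMDiffRiemannianMetric hg)) := by
  set μ : Measure M := riemannianMeasure (g.toContMDiffRiemannianMetric hg) with hμ
  haveI : IsFiniteMeasure μ := isFiniteMeasure_riemannianMeasure _
  -- the density `ρ = c w²` and the probability measure `ν = ρ dV`
  set ρ : M → ℝ≥0∞ := fun x ↦ ENNReal.ofReal (c * w x ^ 2) with hρ
  have hcw : Continuous fun x ↦ c * w x ^ 2 := continuous_const.mul (hw.pow 2)
  have hρm : Measurable ρ := ENNReal.measurable_ofReal.comp hcw.measurable
  have hρtop : ∀ᵐ x ∂μ, ρ x < (⊤ : ℝ≥0∞) := ae_of_all _ fun x ↦ ENNReal.ofReal_lt_top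
  have hnn : ∀ x, 0 ≤ c * w x ^ 2 := fun x ↦ mul_nonneg hc (sq_nonneg _)
  set ν : Measure M := μ.withDensity ρ with hν
  haveI : IsProbabilityMeasure ν := by
    refine ⟨?_⟩
    rw [hν, withDensity_apply _ MeasurableSet.univ, Measure.restrict_univ,
      ← ofReal_integral_eq_lintegral_ofReal (integrable_of_continuous g hg hcw)
        (ae_of_all _ hnn), hnorm, ENNReal.ofReal_one]
  -- integrals against `ν` are weighted integrals against `dV`
  have hconv : ∀ F : M → ℝ, ∫ x, F x ∂ν = ∫ x, c * w x ^ 2 * F x ∂μ := by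
    intro F
    rw [hν, integral_withDensity_eq_integral_toReal_smul hρm hρtop]
    refine integral_congr_ae (ae_of_all _ fun x ↦ ?_)
    simp only [hρ, ENNReal.toReal_ofReal (hnn x), smul_eq_mul]
  -- Jensen for `s ↦ s log s` on `[0, ∞)` and `f = χ²`
  have hχ2 : Continuous fun x ↦ χ x ^ 2 := hχ.pow 2
  have hJ := ConvexOn.map_integral_le (μ := ν) (f := fun x ↦ χ x ^ 2)
    (g := fun s ↦ s * Real.log s) (s := Ici (0 : ℝ)) Real.convexOn_mul_log
    Real.continuous_mul_log.continuousOn isClosed_Ici (ae_of_all _ fun x ↦ sq_nonneg (χ x))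
    (integrable_of_continuous_finite hχ2 ν)
    (integrable_of_continuous_finite (Real.continuous_mul_log.comp hχ2) ν)
  rw [hconv, hconv] at hJ
  exact hJ

/-- **Localisation inequality for Perelman's `𝒲`-functional (two pieces).** On a closed Riemannian
4-manifold, for `τ > 0`, `c = (4πτ)⁻²`, smooth `χ₁, χ₂` with `χ₁² + χ₂² = 1` and a smooth `w` with
`∫ c w² dV = 1`:
`𝒲(χ₁w) + 𝒲(χ₂w) + m₁ log m₁ + m₂ log m₂ − 4τ ∫ c w² (|∇χ₁|² + |∇χ₂|²) dV ≤ 𝒲(w)`, where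
`𝒲(v) = ∫ [τ(R v² + 4|∇v|²) − v² log v² − 4v²] c dV` and `mᵢ = ∫ c w² χᵢ² dV`. (With `ŵᵢ = χᵢw/√mᵢ`
normalised, `𝒲(χᵢ w) + mᵢ log mᵢ = mᵢ 𝒲(ŵᵢ)`, so this reads `𝒲(w) ≥ Σ mᵢ 𝒲(ŵᵢ) − 4τ ∫ c w² Σ|∇χᵢ|²`.)
IMS localisation (Cycon–Froese–Kirsch–Simon 1987, Thm. 3.2) + Jensen for `s log s`. -/
theorem wEntropy_localisation_two' [g.HasLeviCivita] (hg : g.IsRiemannian) {τ : ℝ} (hτ : 0 < τ)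
    {χ₁ χ₂ w : M → ℝ}
    (hχ₁ : ContMDiff (𝓡 4) 𝓘(ℝ, ℝ) ∞ χ₁) (hχ₂ : ContMDiff (𝓡 4) 𝓘(ℝ, ℝ) ∞ χ₂)
    (hw : ContMDiff (𝓡 4) 𝓘(ℝ, ℝ) ∞ w) (h1 : ∀ y, χ₁ y ^ 2 + χ₂ y ^ 2 = 1)
    (hnorm : ∫ x, (4 * Real.pi * τ) ^ (-(4 : ℝ) / 2) * w x ^ 2
      ∂(riemannianMeasure (g.toContMDiffRiemannianMetric hg)) = 1) :
    (∫ x, (τ * (g.scalarCurvature x * (χ₁ x * w x) ^ 2 + 4 * g.gradSq (fun y ↦ χ₁ y * w y) x)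
          - (χ₁ x * w x) ^ 2 * Real.log ((χ₁ x * w x) ^ 2) - 4 * (χ₁ x * w x) ^ 2)
          * (4 * Real.pi * τ) ^ (-(4 : ℝ) / 2) ∂(riemannianMeasure (g.toContMDiffRiemannianMetric hg)))
      + (∫ x, (τ * (g.scalarCurvature x * (χ₂ x * w x) ^ 2 + 4 * g.gradSq (fun y ↦ χ₂ y * w y) x)
          - (χ₂ x * w x) ^ 2 * Real.log ((χ₂ x * w x) ^ 2) - 4 * (χ₂ x * w x) ^ 2)
          * (4 * Real.pi * τ) ^ (-(4 : ℝ) / 2) ∂(riemannianMeasure (g.toContMDiffRiemannianMetric hg)))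
      + (∫ x, (4 * Real.pi * τ) ^ (-(4 : ℝ) / 2) * w x ^ 2 * χ₁ x ^ 2
            ∂(riemannianMeasure (g.toContMDiffRiemannianMetric hg))) *
          Real.log (∫ x, (4 * Real.pi * τ) ^ (-(4 : ℝ) / 2) * w x ^ 2 * χ₁ x ^ 2
            ∂(riemannianMeasure (g.toContMDiffRiemannianMetric hg)))
      + (∫ x, (4 * Real.pi * τ) ^ (-(4 : ℝ) / 2) * w x ^ 2 * χ₂ x ^ 2
            ∂(riemannianMeasure (g.toContMDiffRiemannianMetric hg))) *
          Real.log (∫ x, (4 * Real.pi * τ) ^ (-(4 : ℝ) / 2) * w x ^ 2 * χ₂ x ^ 2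
            ∂(riemannianMeasure (g.toContMDiffRiemannianMetric hg)))
      - 4 * τ * ∫ x, (4 * Real.pi * τ) ^ (-(4 : ℝ) / 2) * w x ^ 2 * (g.gradSq χ₁ x + g.gradSq χ₂ x)
            ∂(riemannianMeasure (g.toContMDiffRiemannianMetric hg))
      ≤ ∫ x, (τ * (g.scalarCurvature x * w x ^ 2 + 4 * g.gradSq w x)
          - w x ^ 2 * Real.log (w x ^ 2) - 4 * w x ^ 2) * (4 * Real.pi * τ) ^ (-(4 : ℝ) / 2)
          ∂(riemannianMeasure (g.toContMDiffRiemannianMetric hg)) := by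
  set μ : Measure M := riemannianMeasure (g.toContMDiffRiemannianMetric hg) with hμ
  set c : ℝ := (4 * Real.pi * τ) ^ (-(4 : ℝ) / 2) with hc
  have hc0 : 0 ≤ c := Real.rpow_nonneg (by positivity) _
  -- smoothness / continuity of the pieces
  have hw₁ : ContMDiff (𝓡 4) 𝓘(ℝ, ℝ) ∞ (fun y ↦ χ₁ y * w y) := hχ₁.mul hw
  have hw₂ : ContMDiff (𝓡 4) 𝓘(ℝ, ℝ) ∞ (fun y ↦ χ₂ y * w y) := hχ₂.mul hw
  have hwc : Continuous w := hw.continuous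
  have hχ₁c : Continuous χ₁ := hχ₁.continuous
  have hχ₂c : Continuous χ₂ := hχ₂.continuous
  have hG₁ : Continuous (g.gradSq χ₁) := (contMDiff_gradSq g hχ₁).continuous
  have hG₂ : Continuous (g.gradSq χ₂) := (contMDiff_gradSq g hχ₂).continuous
  -- the pointwise identity of the densities
  have hpt : ∀ x,
      (τ * (g.scalarCurvature x * (χ₁ x * w x) ^ 2 + 4 * g.gradSq (fun y ↦ χ₁ y * w y) x)
          - (χ₁ x * w x) ^ 2 * Real.log ((χ₁ x * w x) ^ 2) - 4 * (χ₁ x * w x) ^ 2) * c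
      + (τ * (g.scalarCurvature x * (χ₂ x * w x) ^ 2 + 4 * g.gradSq (fun y ↦ χ₂ y * w y) x)
          - (χ₂ x * w x) ^ 2 * Real.log ((χ₂ x * w x) ^ 2) - 4 * (χ₂ x * w x) ^ 2) * c
      = (τ * (g.scalarCurvature x * w x ^ 2 + 4 * g.gradSq w x)
          - w x ^ 2 * Real.log (w x ^ 2) - 4 * w x ^ 2) * c
        + 4 * τ * (c * w x ^ 2 * (g.gradSq χ₁ x + g.gradSq χ₂ x))
        - (c * w x ^ 2 * (χ₁ x ^ 2 * Real.log (χ₁ x ^ 2))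
          + c * w x ^ 2 * (χ₂ x ^ 2 * Real.log (χ₂ x ^ 2))) := by
    intro x
    have e1 := sq_mul_log_sq_mul (χ₁ x) (w x)
    have e2 := sq_mul_log_sq_mul (χ₂ x) (w x)
    have e3 := gradSq_localisation_two g h1 ((hχ₁ x).mdifferentiableAt (by simp))
      ((hχ₂ x).mdifferentiableAt (by simp)) ((hw x).mdifferentiableAt (by simp))
    have e4 := h1 x
    rw [e1, e2]
    linear_combination (4 * τ * c) * e3 +
      (c * τ * g.scalarCurvature x * w x ^ 2 - 4 * c * w x ^ 2
        - c * (w x ^ 2 * Real.log (w x ^ 2))) * e4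
  -- integrability
  have hI₁ := integrable_of_continuous g hg (continuous_wDensity g hw₁ τ c)
  have hI₂ := integrable_of_continuous g hg (continuous_wDensity g hw₂ τ c)
  have hIw := integrable_of_continuous g hg (continuous_wDensity g hw τ c)
  have hcw : Continuous fun x ↦ c * w x ^ 2 := continuous_const.mul (hwc.pow 2)
  have hIG : Integrable (fun x ↦ c * w x ^ 2 * (g.gradSq χ₁ x + g.gradSq χ₂ x)) μ :=
    integrable_of_continuous g hg (hcw.mul (hG₁.add hG₂))
  have hIL₁ : Integrable (fun x ↦ c * w x ^ 2 * (χ₁ x ^ 2 * Real.log (χ₁ x ^ 2))) μ :=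
    integrable_of_continuous g hg (hcw.mul (Real.continuous_mul_log.comp (hχ₁c.pow 2)))
  have hIL₂ : Integrable (fun x ↦ c * w x ^ 2 * (χ₂ x ^ 2 * Real.log (χ₂ x ^ 2))) μ :=
    integrable_of_continuous g hg (hcw.mul (Real.continuous_mul_log.comp (hχ₂c.pow 2)))
  -- integrate the pointwise identity
  have hsum : (∫ x, (τ * (g.scalarCurvature x * (χ₁ x * w x) ^ 2 + 4 * g.gradSq (fun y ↦ χ₁ y * w y) x)
          - (χ₁ x * w x) ^ 2 * Real.log ((χ₁ x * w x) ^ 2) - 4 * (χ₁ x * w x) ^ 2) * c ∂μ)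
      + (∫ x, (τ * (g.scalarCurvature x * (χ₂ x * w x) ^ 2 + 4 * g.gradSq (fun y ↦ χ₂ y * w y) x)
          - (χ₂ x * w x) ^ 2 * Real.log ((χ₂ x * w x) ^ 2) - 4 * (χ₂ x * w x) ^ 2) * c ∂μ)
      = (∫ x, (τ * (g.scalarCurvature x * w x ^ 2 + 4 * g.gradSq w x)
          - w x ^ 2 * Real.log (w x ^ 2) - 4 * w x ^ 2) * c ∂μ)
        + 4 * τ * (∫ x, c * w x ^ 2 * (g.gradSq χ₁ x + g.gradSq χ₂ x) ∂μ)
        - ((∫ x, c * w x ^ 2 * (χ₁ x ^ 2 * Real.log (χ₁ x ^ 2)) ∂μ)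
          + ∫ x, c * w x ^ 2 * (χ₂ x ^ 2 * Real.log (χ₂ x ^ 2)) ∂μ) := by
    rw [← hμ] at hI₁ hI₂ hIw
    have key : ∫ x, ((τ * (g.scalarCurvature x * (χ₁ x * w x) ^ 2
            + 4 * g.gradSq (fun y ↦ χ₁ y * w y) x)
          - (χ₁ x * w x) ^ 2 * Real.log ((χ₁ x * w x) ^ 2) - 4 * (χ₁ x * w x) ^ 2) * c
        + (τ * (g.scalarCurvature x * (χ₂ x * w x) ^ 2 + 4 * g.gradSq (fun y ↦ χ₂ y * w y) x)
          - (χ₂ x * w x) ^ 2 * Real.log ((χ₂ x * w x) ^ 2) - 4 * (χ₂ x * w x) ^ 2) * c) ∂μ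
        = ∫ x, ((τ * (g.scalarCurvature x * w x ^ 2 + 4 * g.gradSq w x)
          - w x ^ 2 * Real.log (w x ^ 2) - 4 * w x ^ 2) * c
          + 4 * τ * (c * w x ^ 2 * (g.gradSq χ₁ x + g.gradSq χ₂ x))
          - (c * w x ^ 2 * (χ₁ x ^ 2 * Real.log (χ₁ x ^ 2))
            + c * w x ^ 2 * (χ₂ x ^ 2 * Real.log (χ₂ x ^ 2)))) ∂μ :=
      integral_congr_ae (ae_of_all _ fun x ↦ hpt x)
    rw [integral_add hI₁ hI₂] at key
    have hG4 : Integrable (fun x ↦ 4 * τ * (c * w x ^ 2 * (g.gradSq χ₁ x + g.gradSq χ₂ x))) μ :=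
      hIG.const_mul (4 * τ)
    have hA : Integrable (fun x ↦ (τ * (g.scalarCurvature x * w x ^ 2 + 4 * g.gradSq w x)
          - w x ^ 2 * Real.log (w x ^ 2) - 4 * w x ^ 2) * c
          + 4 * τ * (c * w x ^ 2 * (g.gradSq χ₁ x + g.gradSq χ₂ x))) μ := hIw.add hG4
    have hB : Integrable (fun x ↦ c * w x ^ 2 * (χ₁ x ^ 2 * Real.log (χ₁ x ^ 2))
          + c * w x ^ 2 * (χ₂ x ^ 2 * Real.log (χ₂ x ^ 2))) μ := hIL₁.add hIL₂
    rw [integral_sub hA hB, integral_add hIw hG4, integral_add hIL₁ hIL₂, integral_const_mul] at key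
    exact key
  -- Jensen on the two mixing terms
  have hJ₁ := mul_log_le_integral_of_sq_density g hg hwc hχ₁c hc0 hnorm
  have hJ₂ := mul_log_le_integral_of_sq_density g hg hwc hχ₂c hc0 hnorm
  linarith [hsum, hJ₁, hJ₂]

end Integral

end EntropyLocalisation

/-- **Localisation inequality for Perelman's `𝒲`-functional (two pieces), registered form** (summit
binder, explicit arguments; see `EntropyLocalisation.wEntropy_localisation_two'`): for `τ > 0`,
`c = (4πτ)⁻²`, smooth `χ₁, χ₂` with `χ₁² + χ₂² = 1` and smooth `w` with `∫ c w² dV = 1`,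
`𝒲(χ₁w) + 𝒲(χ₂w) + m₁ log m₁ + m₂ log m₂ − 4τ ∫ c w² (|∇χ₁|² + |∇χ₂|²) dV ≤ 𝒲(w)`. Helper for
stub `stub_conformalGluing` of line `green-blowup-conformal-entropy` (crux stmt-SmoothPoincare4-10871).
Cycon–Froese–Kirsch–Simon 1987, Thm. 3.2 (IMS); Jensen. -/
theorem wEntropy_localisation_two :
    ∀ (M : Type) [TopologicalSpace M] [T2Space M] [SecondCountableTopology M]
      [ChartedSpace (EuclideanSpace ℝ (Fin 4)) M] [IsManifold (𝓡 4) ∞ M] [CompactSpace M]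
      [T3Space M] [MeasurableSpace M] [BorelSpace M]
      (g : PseudoRiemannianMetric (𝓡 4) ∞ (EuclideanSpace ℝ (Fin 4)) (TangentSpace (𝓡 4) : M → Type _))
      [g.HasLeviCivita] (hg : g.IsRiemannian) (τ : ℝ), 0 < τ → ∀ (χ₁ χ₂ w : M → ℝ),
      ContMDiff (𝓡 4) 𝓘(ℝ, ℝ) ∞ χ₁ → ContMDiff (𝓡 4) 𝓘(ℝ, ℝ) ∞ χ₂ → ContMDiff (𝓡 4) 𝓘(ℝ, ℝ) ∞ w →
      (∀ y, χ₁ y ^ 2 + χ₂ y ^ 2 = 1) →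
      ∫ x, (4 * Real.pi * τ) ^ (-(4 : ℝ) / 2) * w x ^ 2
        ∂(riemannianMeasure (g.toContMDiffRiemannianMetric hg)) = 1 →
    (∫ x, (τ * (g.scalarCurvature x * (χ₁ x * w x) ^ 2 + 4 * g.gradSq (fun y ↦ χ₁ y * w y) x)
          - (χ₁ x * w x) ^ 2 * Real.log ((χ₁ x * w x) ^ 2) - 4 * (χ₁ x * w x) ^ 2)
          * (4 * Real.pi * τ) ^ (-(4 : ℝ) / 2) ∂(riemannianMeasure (g.toContMDiffRiemannianMetric hg)))
      + (∫ x, (τ * (g.scalarCurvature x * (χ₂ x * w x) ^ 2 + 4 * g.gradSq (fun y ↦ χ₂ y * w y) x)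
          - (χ₂ x * w x) ^ 2 * Real.log ((χ₂ x * w x) ^ 2) - 4 * (χ₂ x * w x) ^ 2)
          * (4 * Real.pi * τ) ^ (-(4 : ℝ) / 2) ∂(riemannianMeasure (g.toContMDiffRiemannianMetric hg)))
      + (∫ x, (4 * Real.pi * τ) ^ (-(4 : ℝ) / 2) * w x ^ 2 * χ₁ x ^ 2
            ∂(riemannianMeasure (g.toContMDiffRiemannianMetric hg))) *
          Real.log (∫ x, (4 * Real.pi * τ) ^ (-(4 : ℝ) / 2) * w x ^ 2 * χ₁ x ^ 2
            ∂(riemannianMeasure (g.toContMDiffRiemannianMetric hg)))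
      + (∫ x, (4 * Real.pi * τ) ^ (-(4 : ℝ) / 2) * w x ^ 2 * χ₂ x ^ 2
            ∂(riemannianMeasure (g.toContMDiffRiemannianMetric hg))) *
          Real.log (∫ x, (4 * Real.pi * τ) ^ (-(4 : ℝ) / 2) * w x ^ 2 * χ₂ x ^ 2
            ∂(riemannianMeasure (g.toContMDiffRiemannianMetric hg)))
      - 4 * τ * ∫ x, (4 * Real.pi * τ) ^ (-(4 : ℝ) / 2) * w x ^ 2 * (g.gradSq χ₁ x + g.gradSq χ₂ x)
            ∂(riemannianMeasure (g.toContMDiffRiemannianMetric hg))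
      ≤ ∫ x, (τ * (g.scalarCurvature x * w x ^ 2 + 4 * g.gradSq w x)
          - w x ^ 2 * Real.log (w x ^ 2) - 4 * w x ^ 2) * (4 * Real.pi * τ) ^ (-(4 : ℝ) / 2)
          ∂(riemannianMeasure (g.toContMDiffRiemannianMetric hg)) := by
  intro M _ _ _ _ _ _ _ _ _ g _ hg τ hτ χ₁ χ₂ w hχ₁ hχ₂ hw h1 hnorm
  exact EntropyLocalisation.wEntropy_localisation_two' g hg hτ hχ₁ hχ₂ hw h1 hnorm

end Summit.SmoothPoincare4.SmoothPoincare4.Theorems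

end
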